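import Summits.BirchSwinnertonDyer.Rank1Residual.X9.LeafDischargeKolyvaginCebotarev
import Summits.BirchSwinnertonDyer.BirchSwinnertonDyer.Theorems.Rank1ResidualJetCebotarevAdapter
import HarnessLib

/-!
# Class X9: the DISCHARGE INTERFACE for Jetchev's Lemma 6.1 in the LOCALISATION currency (`h61`
# of bsd-jet's abstract Thm. 6.3) on X9 Heegner frames — a Kolyvagin prime `ℓ ∉ S` of index `≥ M`
# whose localisation preserves the orders of two opposite eigenclasses, UNCONDITIONALLY

Print-tier cell `bsd-print-x9` (D-0131 (2), key `x9`), typer seat ty2, file H of the discharge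
interface (sequel of F = `X9/LeafDischargeKolyvaginCebotarev`). Theorems only: no definition, no
new named fact (D-0014 / D-0026); nothing here is a class theorem.

bsd-jet's abstract kernel of Jetchev 2008 Thm. 6.3 (`JET.Section6…`, the engine behind the
surjective road `JET.sha_card_add_tamagawa_le_index_of_carrierNe`) consumes the Čebotarev step as
`h61 : ∀ x y, y ≠ 0 → ∃ ℓ ∉ S, … addOrderOf (loc_λ x) = addOrderOf x ∧ addOrderOf (loc_λ y) = addOrderOf y`
— its adapter `JET.exists_kolyvaginPrime_addOrderOf_localization_eq_of_cor32` derives it from the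
named fact `McCallum1991.cor32_eigenclasses_infinite_primes_localOrder` (surjective tower), and the
bsd-potss twin `JetchevIrreducibleReadingThm52.exists_kolyvaginPrime_addOrderOf_localization_eq_of_cor32Irred`
from the displayed GLOBAL irreducible reading `h32I` (false in that generality: dihedral images). This
file runs the SAME adapter (byte-for-byte: independence of opposite eigenclasses
`JET.dvd_of_zsmul_add_zsmul_eq_zero_of_eigen`, the order dictionary
`JET.addOrderOf_map_eq_of_forall_map_nsmul_eq_zero_iff`, `torsionLocalKer = ker loc_λ`) on a
PER-FRAME Cor. 3.2:

* `exists_kolyvaginPrime_addOrderOf_localization_eq_of_cor32Frame` — for one `(N, W, K, p, τ, M)`,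
  McCallum's Cor. 3.2 at level `p^M` in Zhang's currency for every independent system of
  `τ`-eigenclasses (hypothesis `h32F`, exactly the shape concluded by file F's
  `ClassX9.cor32_localOrder_of_heegner` and by the tree's
  `JetchevIrreducibleCebotarev.cor32_localOrder_of_image` / `…_of_irreducible_of_unramified`) ⟹ `h61`
  for that frame. Route-free, image-free: any lane's per-frame Cor. 3.2 feeds it.
* **`ClassX9.exists_kolyvaginPrime_addOrderOf_localization_eq_of_heegner`** — `h61` on every X9
  Heegner frame (`ClassX9 W p`, `K` imaginary quadratic with the Heegner hypothesis for `N_E`, `p`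
  split in `K`), UNCONDITIONAL (file F). This is the `h61` input of the Thm. 6.3 kernel for the
  crux J = `HeegnerDivisibilityX9` (item stmt-BirchSwinnertonDyer-20392, stub `stub_jetchevX9`).
* `ClassX10.exists_kolyvaginPrime_addOrderOf_localization_eq_of_heegner` — the X10b twin at
  `p = 3` (`3` split in `K`), for the banked Heegner road at `3` (`Theorems/PrintX10bHeegnerRoad`).

## References

* [Jetchev2008] D. Jetchev, Compos. Math. 144 (2008), Lemma 5.1 (p. 821) (= arXiv Lemma 6.1),
  Rem. 6.2, Thm. 6.3.
* [McCallumLMS1991] W. G. McCallum, LMS LN 153 (1991), §3 Cor. 3.2 (p. 299), §3 p. 298 (local orders).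
-/

set_option autoImplicit false

noncomputable section

open scoped Classical

universe u

open WeierstrassCurve IsDedekindDomain NumberField Literature.NumberTheory.EllipticCurves
  Literature.NumberTheory.EllipticCurves.ModularForms Literature.NumberTheory.GaloisRepresentations
  Summit.BirchSwinnertonDyer.Rank1Residual.JET

namespace Literature.NumberTheory.EllipticCurves.Rank1Residual

/-! ### 1. From a per-frame Cor. 3.2 to `h61` -/

/-- **[J] Lemma 6.1 in the `h61` currency from a PER-FRAME Cor. 3.2.** Fix `N`, `W/ℚ`, `K` imaginary
quadratic, an odd prime `p`, the complex conjugation `τ ≠ 1` of `K`, a level `p^M` (`M ≥ 1`).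
Suppose McCallum's Cor. 3.2 at level `p^M` holds for this frame in Zhang's currency (`h32F`: for
every finite independent system of non-zero `τ`-eigenclasses `c_i ∈ H¹(K, E[p^M])` with
`ord c_i = p^{M_i}` and exponents `N_i ≤ M_i`, infinitely many Kolyvagin primes `ℓ` of index `≥ M`
with `p^j c_i ∈ ker loc_λ ↔ N_i ≤ j`). Then for a class `x` with `τx = e x` and a NON-ZERO class `y`
with `τy = −e y` (`e = ±1`) and any finite set `S` of primes there is a Kolyvagin prime `ℓ ∉ S` of
index `≥ M` whose localisation at `λ ∣ ℓ` preserves `ord x` and `ord y`. Proof: bsd-jet's adapter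
`JET.exists_kolyvaginPrime_addOrderOf_localization_eq_of_cor32` byte-for-byte (systems `(y)` /
`(x, y)`, independence `dvd_of_zsmul_add_zsmul_eq_zero_of_eigen`, `N_i := M_i`, dictionary
`mem_torsionLocalKer_iff_res_eq_zero`). [cite: Jetchev2008, Lemma 5.1 (p. 821), Rem. 6.2]
[cite: McCallumLMS1991, §3 Cor. 3.2 (p. 299)] -/
theorem exists_kolyvaginPrime_addOrderOf_localization_eq_of_cor32Frame
    (N : ℕ) [NeZero N] (W : WeierstrassCurve ℚ) [W.IsElliptic] [W.IsGloballyMinimal]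
    (K : Type) [Field K] [NumberField K]
    (p : ℕ) [Fact p.Prime] (hp2 : p ≠ 2) (τ : K ≃ₐ[ℚ] K) (M : ℕ)
    (h32F : ∀ (r : ℕ) (cs : Fin r → galH1Torsion (W.baseChange K) ((p ^ M : ℕ) : ℤ)),
        (∀ i, cs i ≠ 0) →
        (∀ i, ∃ e : ℤ, (e = 1 ∨ e = -1) ∧ conjAct W τ ((p ^ M : ℕ) : ℤ) (cs i) = e • cs i) →
        (∀ a : Fin r → ℤ, ∑ i, a i • cs i = 0 → ∀ i, (addOrderOf (cs i) : ℤ) ∣ a i) →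
        ∀ (Mi : Fin r → ℕ), (∀ i, addOrderOf (cs i) = p ^ Mi i) →
        ∀ (Nv : Fin r → ℕ), (∀ i, Nv i ≤ Mi i) →
          Set.Infinite {ℓ : ℕ | FrobEqFrobInfty W K (p ^ M) ℓ ∧
            Zhang2014.IsKolyvaginPrime N W K p ℓ ∧ M ≤ Zhang2014.kolyvaginIndex W p ℓ ∧
            ∀ i, ∀ v : HeightOneSpectrum (𝓞 K), (ℓ : 𝓞 K) ∈ v.asIdeal →
              ∀ j : ℕ, ((p ^ j : ℕ) : ℤ) • cs i ∈
                  (W.baseChange K).torsionLocalKer (v.adicCompletion K) ((p ^ M : ℕ) : ℤ) ↔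
                Nv i ≤ j})
    {e : ℤ} (he : e = 1 ∨ e = -1)
    (x y : galH1Torsion (W.baseChange K) ((p ^ M : ℕ) : ℤ))
    (hx : conjAct W τ ((p ^ M : ℕ) : ℤ) x = e • x) (hy : conjAct W τ ((p ^ M : ℕ) : ℤ) y = (-e) • y)
    (hy0 : y ≠ 0) (S : Finset ℕ) :
    ∃ ℓ : ℕ, ℓ ∉ S ∧ Zhang2014.IsKolyvaginPrime N W K p ℓ ∧ M ≤ Zhang2014.kolyvaginIndex W p ℓ ∧
      ∀ v : HeightOneSpectrum (𝓞 K), (ℓ : 𝓞 K) ∈ v.asIdeal →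
        addOrderOf (galoisCohomology.localization
            ((W.baseChange K).torsionGaloisModule ((p ^ M : ℕ) : ℤ)) (Sum.inr v) 1 x) = addOrderOf x ∧
        addOrderOf (galoisCohomology.localization
            ((W.baseChange K).torsionGaloisModule ((p ^ M : ℕ) : ℤ)) (Sum.inr v) 1 y) = addOrderOf y := by
  have hp : p.Prime := Fact.out
  -- every class is killed by `p^M`, so orders are powers of `p` (and prime to `2`)
  have hkill : ∀ z : galH1Torsion (W.baseChange K) ((p ^ M : ℕ) : ℤ), p ^ M • z = 0 := fun z ↦
    galoisCohomology.nsmul_eq_zero_of_forall ((W.baseChange K).torsionGaloisModule ((p ^ M : ℕ) : ℤ))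
      (fun T ↦ by
        have h := (W.baseChange K).natAbs_nsmul_geomTorsion T
        rwa [Int.natAbs_natCast] at h) z
  have hordpow : ∀ z : galH1Torsion (W.baseChange K) ((p ^ M : ℕ) : ℤ), ∃ k ≤ M, addOrderOf z = p ^ k :=
    fun z ↦ (Nat.dvd_prime_pow hp).mp (addOrderOf_dvd_of_nsmul_eq_zero (hkill z))
  have hcop2 : ∀ z : galH1Torsion (W.baseChange K) ((p ^ M : ℕ) : ℤ), (addOrderOf z).Coprime 2 := by
    intro z
    obtain ⟨k, -, hk⟩ := hordpow z
    rw [hk]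
    exact Nat.Coprime.pow_left _ ((Nat.coprime_primes hp Nat.prime_two).mpr hp2)
  -- the localisation at the place `v`, typed on `galH1Torsion` (= `galoisCohomology _ 1` by `rfl`)
  let loc : ∀ v : HeightOneSpectrum (𝓞 K), galH1Torsion (W.baseChange K) ((p ^ M : ℕ) : ℤ) →+
      galoisCohomology (((W.baseChange K).torsionGaloisModule ((p ^ M : ℕ) : ℤ)).toLocal (Sum.inr v)) 1 :=
    fun v ↦ galoisCohomology.localization ((W.baseChange K).torsionGaloisModule ((p ^ M : ℕ) : ℤ))
      (Sum.inr v) 1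
  -- dictionary: multiples in `torsionLocalKer` = multiples killed by the localisation
  have hloc : ∀ (v : HeightOneSpectrum (𝓞 K)) (z : galH1Torsion (W.baseChange K) ((p ^ M : ℕ) : ℤ))
      (j : ℕ), loc v (p ^ j • z) = 0 ↔
        ((p ^ j : ℕ) : ℤ) • z ∈ (W.baseChange K).torsionLocalKer (v.adicCompletion K) ((p ^ M : ℕ) : ℤ) := by
    intro v z j
    haveI : CharZero (v.adicCompletion K) := charZero_of_injective_algebraMap (algebraMap K _).injective
    rw [natCast_zsmul, mem_torsionLocalKer_iff_res_eq_zero (W := W.baseChange K)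
      (E := v.adicCompletion K) (pow_ne_zero M hp.ne_zero)]
    exact Iff.rfl
  obtain ⟨b, -, hb⟩ := hordpow y
  have hey : (-e = 1 ∨ -e = -1) := by rcases he with rfl | rfl <;> norm_num
  -- apply Cor 3.2 to an independent system of eigenclasses containing `y` (and `x` if `x ≠ 0`)
  have key : ∃ T : Set ℕ, T.Infinite ∧ ∀ ℓ ∈ T, Zhang2014.IsKolyvaginPrime N W K p ℓ ∧
      M ≤ Zhang2014.kolyvaginIndex W p ℓ ∧ ∀ v : HeightOneSpectrum (𝓞 K), (ℓ : 𝓞 K) ∈ v.asIdeal →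
        addOrderOf (loc v x) = addOrderOf x ∧ addOrderOf (loc v y) = addOrderOf y := by
    by_cases hx0 : x = 0
    · -- the system `(y)`
      have hinf := h32F 1 ![y]
        (by intro i; fin_cases i; exact hy0)
        (by intro i; fin_cases i; exact ⟨-e, hey, hy⟩)
        (by
          intro a ha i
          fin_cases i
          have ha' : a 0 • y = 0 := by simpa using ha
          exact addOrderOf_dvd_iff_zsmul_eq_zero.mpr ha')
        ![b] (by intro i; fin_cases i; exact hb) ![b] (fun _ ↦ le_rfl)
      refine ⟨_, hinf, fun ℓ hℓ ↦ ⟨hℓ.2.1, hℓ.2.2.1, fun v hv ↦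
        ⟨by rw [hx0, map_zero, addOrderOf_zero, addOrderOf_zero], ?_⟩⟩⟩
      rw [hb]
      exact addOrderOf_map_eq_of_forall_map_nsmul_eq_zero_iff (loc v) hp fun j ↦ by
        rw [hloc v y j]; simpa using hℓ.2.2.2 0 v hv j
    · -- the system `(x, y)`
      obtain ⟨a, -, ha⟩ := hordpow x
      have hinf := h32F 2 ![x, y]
        (by
          intro i
          fin_cases i
          · exact hx0
          · exact hy0)
        (by
          intro i
          fin_cases i
          · exact ⟨e, he, hx⟩
          · exact ⟨-e, hey, hy⟩)
        (by
          intro c hc i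
          have hc' : c 0 • x + c 1 • y = 0 := by simpa [Fin.sum_univ_two] using hc
          obtain ⟨h0, h1⟩ := dvd_of_zsmul_add_zsmul_eq_zero_of_eigen (conjAct W τ ((p ^ M : ℕ) : ℤ)) he
            hx hy (hcop2 x) (hcop2 y) hc'
          fin_cases i
          · exact h0
          · exact h1)
        ![a, b]
        (by
          intro i
          fin_cases i
          · exact ha
          · exact hb)
        ![a, b] (fun _ ↦ le_rfl)
      refine ⟨_, hinf, fun ℓ hℓ ↦ ⟨hℓ.2.1, hℓ.2.2.1, fun v hv ↦ ⟨?_, ?_⟩⟩⟩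
      · rw [ha]
        exact addOrderOf_map_eq_of_forall_map_nsmul_eq_zero_iff (loc v) hp fun j ↦ by
          rw [hloc v x j]; simpa using hℓ.2.2.2 0 v hv j
      · rw [hb]
        exact addOrderOf_map_eq_of_forall_map_nsmul_eq_zero_iff (loc v) hp fun j ↦ by
          rw [hloc v y j]; simpa using hℓ.2.2.2 1 v hv j
  obtain ⟨T, hT, hTprop⟩ := key
  obtain ⟨ℓ, hℓT, hℓS⟩ := hT.exists_notMem_finset S
  exact ⟨ℓ, hℓS, hTprop ℓ hℓT⟩

/-! ### 2. `h61` on X9 Heegner frames -/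

section X9

variable {W : WeierstrassCurve ℚ} [W.IsElliptic] [W.IsGloballyMinimal] {p : ℕ} [Fact p.Prime]

/-- **[J] Lemma 6.1 (= [McC] Cor. 3.2) in the `h61` currency on every X9 Heegner frame —
UNCONDITIONAL.** For an X9 pair `(E, p)`, `K` imaginary quadratic with the Heegner hypothesis for
`N_E` and `p` split in `K`, the complex conjugation `τ ≠ 1`, a level `p^M` (`M ≥ 1`), a class `x` with
`τx = e x` and a NON-ZERO class `y` with `τy = −e y` (`e = ±1`) in `H¹(K, E[p^M])`, and any finite set
`S` of primes: there is a Kolyvagin prime `ℓ ∉ S` (`Zhang2014.IsKolyvaginPrime N W K p ℓ`, free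
level `N`) of index `M(ℓ) ≥ M` whose localisation at the place `λ ∣ ℓ` preserves `ord x` and
`ord y`. = file F's `ClassX9.cor32_localOrder_of_heegner` through
`exists_kolyvaginPrime_addOrderOf_localization_eq_of_cor32Frame`; the `h61` input of bsd-jet's
Thm. 6.3 kernel for the crux J (`HeegnerDivisibilityX9`, item 20392).
[cite: Jetchev2008, Lemma 5.1 (p. 821), Rem. 6.2] [cite: McCallumLMS1991, §3 Cor. 3.2 (p. 299)] -/
theorem ClassX9.exists_kolyvaginPrime_addOrderOf_localization_eq_of_heegner (h : ClassX9 W p)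
    (N : ℕ) [NeZero N] (K : Type) [Field K] [NumberField K] (hK : IsImaginaryQuadratic K)
    (hHN : SatisfiesHeegnerHypothesis (W.conductorNorm ℤ) K) (hHp : SatisfiesHeegnerHypothesis p K)
    (τ : K ≃ₐ[ℚ] K) (hτ : τ ≠ 1) (M : ℕ) (hM : 1 ≤ M) {e : ℤ} (he : e = 1 ∨ e = -1)
    (x y : galH1Torsion (W.baseChange K) ((p ^ M : ℕ) : ℤ))
    (hx : conjAct W τ ((p ^ M : ℕ) : ℤ) x = e • x) (hy : conjAct W τ ((p ^ M : ℕ) : ℤ) y = (-e) • y)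
    (hy0 : y ≠ 0) (S : Finset ℕ) :
    ∃ ℓ : ℕ, ℓ ∉ S ∧ Zhang2014.IsKolyvaginPrime N W K p ℓ ∧ M ≤ Zhang2014.kolyvaginIndex W p ℓ ∧
      ∀ v : HeightOneSpectrum (𝓞 K), (ℓ : 𝓞 K) ∈ v.asIdeal →
        addOrderOf (galoisCohomology.localization
            ((W.baseChange K).torsionGaloisModule ((p ^ M : ℕ) : ℤ)) (Sum.inr v) 1 x) = addOrderOf x ∧
        addOrderOf (galoisCohomology.localization
            ((W.baseChange K).torsionGaloisModule ((p ^ M : ℕ) : ℤ)) (Sum.inr v) 1 y) = addOrderOf y :=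
  exists_kolyvaginPrime_addOrderOf_localization_eq_of_cor32Frame N W K p h.ne_two τ M
    (fun r cs h0 hτ' hind Mi hMi Nv hNv ↦
      h.cor32_localOrder_of_heegner N K hK hHN hHp τ hτ M hM r cs h0 hτ' hind Mi hMi Nv hNv)
    he x y hx hy hy0 S

end X9

/-! ### 3. `h61` on X10b Heegner frames (`p = 3`, `3` split) -/

section X10b

variable {W : WeierstrassCurve ℚ} [W.IsElliptic] [W.IsGloballyMinimal] {p : ℕ} [Fact p.Prime]

/-- **[J] Lemma 6.1 (= [McC] Cor. 3.2) in the `h61` currency on every X10b Heegner frame —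
UNCONDITIONAL** (a Kolyvagin prime `ℓ ∉ S` of index `M(ℓ) ≥ M` whose localisation preserves the
orders of a `τ`-eigenclass `x` and a non-zero opposite eigenclass `y` in `H¹(K, E[3^M])`): file
F's `ClassX10.cor32_localOrder_of_heegner` through file H's per-frame adapter.
[cite: Jetchev2008, Lemma 5.1 (p. 821), Rem. 6.2] [cite: McCallumLMS1991, §3 Cor. 3.2 (p. 299)] -/
theorem ClassX10.exists_kolyvaginPrime_addOrderOf_localization_eq_of_heegner (h : ClassX10 W p)
    (N : ℕ) [NeZero N] (K : Type) [Field K] [NumberField K] (hK : IsImaginaryQuadratic K)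
    (hHN : SatisfiesHeegnerHypothesis (W.conductorNorm ℤ) K) (hHp : SatisfiesHeegnerHypothesis p K)
    (τ : K ≃ₐ[ℚ] K) (hτ : τ ≠ 1) (M : ℕ) (hM : 1 ≤ M) {e : ℤ} (he : e = 1 ∨ e = -1)
    (x y : galH1Torsion (W.baseChange K) ((p ^ M : ℕ) : ℤ))
    (hx : conjAct W τ ((p ^ M : ℕ) : ℤ) x = e • x) (hy : conjAct W τ ((p ^ M : ℕ) : ℤ) y = (-e) • y)
    (hy0 : y ≠ 0) (S : Finset ℕ) :
    ∃ ℓ : ℕ, ℓ ∉ S ∧ Zhang2014.IsKolyvaginPrime N W K p ℓ ∧ M ≤ Zhang2014.kolyvaginIndex W p ℓ ∧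
      ∀ v : HeightOneSpectrum (𝓞 K), (ℓ : 𝓞 K) ∈ v.asIdeal →
        addOrderOf (galoisCohomology.localization
            ((W.baseChange K).torsionGaloisModule ((p ^ M : ℕ) : ℤ)) (Sum.inr v) 1 x) = addOrderOf x ∧
        addOrderOf (galoisCohomology.localization
            ((W.baseChange K).torsionGaloisModule ((p ^ M : ℕ) : ℤ)) (Sum.inr v) 1 y) = addOrderOf y :=
  exists_kolyvaginPrime_addOrderOf_localization_eq_of_cor32Frame N W K p
    (by obtain ⟨hp3, -⟩ := h; omega) τ M
    (fun r cs h0 hτ' hind Mi hMi Nv hNv ↦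
      h.cor32_localOrder_of_heegner N K hK hHN hHp τ hτ M hM r cs h0 hτ' hind Mi hMi Nv hNv)
    he x y hx hy hy0 S

end X10b

end Literature.NumberTheory.EllipticCurves.Rank1Residual

end
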